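import Mathlib.Order.WellQuasiOrder
import Mathlib.Order.WellFoundedSet
import Mathlib.Order.OrderIsoNat
import Mathlib.Data.List.NodupEquivFin
import Mathlib.Data.List.OfFn
import HarnessLib

/-!
# Antitone sequences in a well-quasi-ordered partial order are well-quasi-ordered

Topic: `Literature/Order/WellQuasiOrder`. A lemma in the theory of well-quasi-orders, isolated
here as the engine of Maclagan's theorem "antichains of monomial ideals are finite"
(`UpperSets.lean`; D. Maclagan, Proc. AMS 129 (2001), Thm. 1.1/1.2, the result invoked by
Cossart–Jannsen–Saito, LNM 2270, proof of Thm. 2.15, for the Noetherianity of the set of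
Hilbert functions):

**Theorem** (`wellQuasiOrderedLE_antitone`). Let `P` be a partial order which is
well-quasi-ordered (Mathlib `WellQuasiOrderedLE`: every sequence `p₀, p₁, …` has `i < j` with
`pᵢ ≤ pⱼ`). Then the set of antitone sequences `s : ℕ → P`, ordered pointwise, is again
well-quasi-ordered.

Proof. `P` is well-founded, so an antitone sequence `s₀ ≥ s₁ ≥ ⋯` is eventually constant, say
from the index `N(s)` on, with value `t(s)`. Encode `s` by the pair (finite list
`(s₀, …, s_{N(s)-1})`, tail `t(s)`). By Higman's lemma (Mathlib
`Set.PartiallyWellOrderedOn.partiallyWellOrderedOn_sublistForall₂`) and Dickson, in any sequence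
of antitone sequences `(sᵐ)` there are `m < n` such that the list of `sᵐ` embeds, term by term
dominated, into a sublist of the list of `sⁿ`, and `t(sᵐ) ≤ t(sⁿ)`. An embedding into a sublist
moves indices to the right (`i ≤ f(i)`), and `sⁿ` is antitone, so `sᵐᵢ ≤ sⁿ_{f(i)} ≤ sⁿᵢ` on the
list part, while beyond it `sᵐᵢ = t(sᵐ) ≤ t(sⁿ) ≤ sⁿᵢ`. Hence `sᵐ ≤ sⁿ` pointwise.

(For a general well-quasi-order `Q` the finite subsets under the "domination" order need not be
well-quasi-ordered — Rado's example; antitonicity is what makes the list encoding work.)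

## Sources

* D. Maclagan, *Antichains of monomial ideals are finite*, Proc. Amer. Math. Soc. 129 (2001)
  1609–1615 = arXiv:math/9909168, Thm. 1.2 (the application). [Maclagan2001]
* G. Higman, Proc. London Math. Soc. (3) 2 (1952) (Higman's lemma, via Mathlib). [folklore]
-/

namespace Literature.Order.WellQuasiOrder

open List

/-! ## Index bookkeeping for embeddings into sublists -/

/-- A strictly monotone map `Fin a → Fin b` dominates the identity on values. [folklore] -/
theorem Fin.val_le_of_strictMono {a b : ℕ} {f : Fin a → Fin b} (hf : StrictMono f) :
    ∀ i : Fin a, (i : ℕ) ≤ f i := by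
  intro ⟨i, hi⟩
  induction i with
  | zero => exact Nat.zero_le _
  | succ i ih =>
    have hlt : f ⟨i, Nat.lt_of_succ_lt hi⟩ < f ⟨i + 1, hi⟩ := hf (Fin.mk_lt_mk.mpr i.lt_succ_self)
    have := ih (Nat.lt_of_succ_lt hi)
    exact Nat.succ_le_of_lt (lt_of_le_of_lt this hlt)

/-- **Index form of `List.SublistForall₂`**: if `l₁` is related termwise by `R` to a sublist of
`l₂`, there is a strictly monotone reindexing `f` with `R (l₁[i]) (l₂[f i])` for all `i`.
[folklore] -/
theorem exists_strictMono_of_sublistForall₂ {α β : Type*} {R : α → β → Prop} {l₁ : List α}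
    {l₂ : List β} (h : SublistForall₂ R l₁ l₂) :
    ∃ f : Fin l₁.length → Fin l₂.length, StrictMono f ∧ ∀ i, R (l₁.get i) (l₂.get (f i)) := by
  obtain ⟨l, hl₁, hl₂⟩ := sublistForall₂_iff.mp h
  obtain ⟨g, hg⟩ := sublist_iff_exists_fin_orderEmbedding_get_eq.mp hl₂
  have hlen : l₁.length = l.length := hl₁.length_eq
  refine ⟨fun i => g (Fin.cast hlen i), fun i j hij => g.strictMono (by simpa using hij), fun i => ?_⟩
  rw [← hg]
  exact hl₁.get i.2 (hlen ▸ i.2)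

/-! ## The theorem -/

variable {P : Type*} [PartialOrder P]

/-- **Antitone sequences in a well-quasi-ordered partial order, ordered pointwise, are
well-quasi-ordered.** [cite: Maclagan2001, Thm. 1.2 (proof engine)] -/
theorem wellQuasiOrderedLE_antitone [WellQuasiOrderedLE P] :
    WellQuasiOrderedLE {s : ℕ → P // Antitone s} := by
  refine ⟨fun F => ?_⟩
  -- stabilisation index `N k` and tail value of the `k`-th sequence
  -- (an antitone sequence in a well-founded partial order is eventually constant:
  -- Mathlib `WellFoundedLT.antitone_chain_condition`)
  choose N hN using fun k => WellFoundedLT.antitone_chain_condition (F k).2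
  let L : ℕ → List P := fun k => List.ofFn fun i : Fin (N k) => (F k).1 i
  let t : ℕ → P := fun k => (F k).1 (N k)
  -- Higman on the lists, Dickson for the pair (list, tail)
  have hP : (Set.univ : Set P).PartiallyWellOrderedOn (· ≤ ·) :=
    Set.partiallyWellOrderedOn_of_wellQuasiOrdered wellQuasiOrdered_le _
  have hL := Set.PartiallyWellOrderedOn.partiallyWellOrderedOn_sublistForall₂ (· ≤ ·) hP
  have hprod := hP.prod hL
  obtain ⟨m, n, hmn, h2, h1⟩ :=
    hprod.exists_lt (f := fun k => (t k, L k)) fun k => ⟨trivial, fun _ _ => trivial⟩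
  refine ⟨m, n, hmn, ?_⟩
  -- compare pointwise
  change ∀ i, (F m).1 i ≤ (F n).1 i
  obtain ⟨g, hg, hR⟩ := exists_strictMono_of_sublistForall₂ h1
  have htail : ∀ i, t n ≤ (F n).1 i := fun i => by
    rcases le_total i (N n) with h | h
    · exact (F n).2 h
    · exact (hN n i h).le
  intro i
  by_cases hi : i < N m
  · -- inside the list of `F m`
    have hlen : (L m).length = N m := List.length_ofFn
    let i' : Fin (L m).length := ⟨i, hlen ▸ hi⟩
    have hget₁ : (L m).get i' = (F m).1 i := by
      simp [L, i']
    have hget₂ : (L n).get (g i') = (F n).1 (g i' : ℕ) := by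
      simp [L]
    have hRi := hR i'
    rw [hget₁, hget₂] at hRi
    have hidx : i ≤ (g i' : ℕ) := Fin.val_le_of_strictMono hg i'
    exact hRi.trans ((F n).2 hidx)
  · -- in the constant tail of `F m`
    push Not at hi
    calc (F m).1 i = t m := (hN m i hi).symm
      _ ≤ t n := h2
      _ ≤ (F n).1 i := htail i

/-- The set form: the antitone sequences with values in a well-quasi-ordered partial order form
a partially well-ordered set of `ℕ → P` for the pointwise order. [cite: Maclagan2001, Thm. 1.2 (proof engine)] -/
theorem isPWO_setOf_antitone [WellQuasiOrderedLE P] : {s : ℕ → P | Antitone s}.IsPWO := by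
  intro F
  obtain ⟨m, n, hmn, hle⟩ :=
    (wellQuasiOrderedLE_antitone (P := P)).wqo fun k => ⟨(F k).1, (F k).2⟩
  exact ⟨m, n, hmn, hle⟩

end Literature.Order.WellQuasiOrder
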